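import Summits.BirchSwinnertonDyer.BirchSwinnertonDyer.Theorems.ManinLocalTwoThreeTameCellIVLocalTwoTorsion
import Mathlib.NumberTheory.Padics.Hensel
import HarnessLib

/-!
# T-desc-IV♮(a) IS A THEOREM: on the tame cell `4 ∥ N`, Kodaira type `IV` at `2`, `E(ℚ₂)[2] = 0 ⟺ Δ_min/2⁴ ≡ 1 (mod 8)`
# (cell bsd-f2-manin, descent lens MEMO-desc §33.15 / desc g15 ADDENDUM 7, prover ask P-desc-2; seat `bsd-line-manin23-p2` gen 12)

Summit `BirchSwinnertonDyer`, route `ManinLocalTwoThree`, crux C2 `ManinOddAtFour` (stmt-BirchSwinnertonDyer-22967), tame cell `4 ∥ N`.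
The descent lens' node T-desc-IV♮(a) `DescG15d.TypeFourLocalTwoTorsionCriterion` (HOME/desc/g15/Sketch-desc-g15d.lean 2350d04c8c9e2a61; census
122/122 + OOS 173/173) says: for `W/ℚ` globally minimal with `4 ∥ N_W` and `v₂(Δ_min) = 4` (type `IV` at `2`), the 2-division cubic has
NO root in `ℚ₂` iff `Δ_min/2⁴ ≡ 1 (mod 8)` — so imc's residual class R-IV′ («IV-optimal with `E₀[2]` reducible over `ℚ₂`») is EXACTLY
the congruence class `Δ_min/16 ≡ 5 (mod 8)`.  THIS FILE PROVES IT BY VALUE (`typeFourLocalTwoTorsionCriterion`, statement verbatim; the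
by-name corollary follows the typer's T-desc-22), along the pipeline of the tree's E-imc-75 proof on the `IV` cell
(`isLocalTwoTorsionX_unique_of_padicValInt_minimalDiscriminantInt_eq_four`): the globally minimal `a₁ = a₃ = 0` companion `M`
(`exists_smul_eq_map_a₁_a₃_eq_zero_of_hasAdditiveReductionAt_two`, a `u = 1` change over `ℚ`) has 2-division polynomial `4·g`,
`g = x³ + a₂x² + a₄x + a₆ ∈ ℤ[x]`, `Δ_min = 16·disc(g)` with `d = disc(g)` ODD.  Then

* a `ℚ₂`-root of `g` is a `ℤ₂`-root (`padic_norm_le_one_of_monic_cubic_root`) and reduces to an `𝔽₂`-root; conversely an `𝔽₂`-root is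
  SIMPLE because `d` is odd (`zmod2_deriv_ne_zero_of_disc`) and lifts by Mathlib's `hensels_lemma` (`exists_intCubic_root_of_zmod2_root`);
* `g` has no `𝔽₂`-root iff `a₆` and `a₂ + a₄` are odd iff `d ≡ 1 (mod 8)` (`zmod8_cubicDisc_eq_one_iff`, `decide` over `(ℤ/8)³`; for odd `d`
  the only other class is `d ≡ 5 (mod 8)`, T-desc-IV♭(a)).

HONEST FRAMING: an E-blind local statement (Tate normal form + Hensel); nothing about Manin's conjecture or BSD is proved.  No definitions,
no named facts, no sorry.
-/

set_option linter.dupNamespace false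
set_option autoImplicit false

noncomputable section

open scoped Classical NumberField
open Polynomial WeierstrassCurve IsDedekindDomain Rat.HeightOneSpectrum Literature.NumberTheory.EllipticCurves
open Summit.BirchSwinnertonDyer.Rank1Residual.ManinAdditive.TameTwoLocal

namespace Summit.BirchSwinnertonDyer.BirchSwinnertonDyer.Theorems.ManinLocalTwoThree

namespace LocalTwoTorsionDiscUnit

/-! ### §1 Transport of local 2-division roots (converses of the tree's `u = 1` / `a₁ = a₃ = 0` lemmas) -/

/-- Converse of `isLocalTwoTorsionX_smul_sub_of_u_eq_one`: a root for `C • W` at `x − r` is a root for `W` at `x`. [folklore] -/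
theorem isLocalTwoTorsionX_of_smul_sub_of_u_eq_one (W : WeierstrassCurve ℚ) (C : VariableChange ℚ) (hu : C.u = 1)
    {x : ℚ_[2]} (hx : IsLocalTwoTorsionX (C • W) (x - (C.r : ℚ_[2]))) : IsLocalTwoTorsionX W x := by
  unfold IsLocalTwoTorsionX at hx ⊢
  rw [variableChange_b₂, variableChange_b₄, variableChange_b₆, hu] at hx
  simp only [inv_one] at hx
  push_cast at hx
  linear_combination hx

/-- Converse of `cubic_eq_zero_of_isLocalTwoTorsionX_map`: a root of `x³ + a₂x² + a₄x + a₆` is a local 2-division root of the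
`a₁ = a₃ = 0` model. [folklore] -/
theorem isLocalTwoTorsionX_map_of_cubic_eq_zero (M : WeierstrassCurve ℤ) (h₁ : M.a₁ = 0) (h₃ : M.a₃ = 0)
    {x : ℚ_[2]} (hx : x ^ 3 + (M.a₂ : ℚ_[2]) * x ^ 2 + (M.a₄ : ℚ_[2]) * x + (M.a₆ : ℚ_[2]) = 0) :
    IsLocalTwoTorsionX (M.map (Int.castRingHom ℚ)) x := by
  unfold IsLocalTwoTorsionX
  simp only [WeierstrassCurve.b₂, WeierstrassCurve.b₄, WeierstrassCurve.b₆, map_a₁, map_a₂, map_a₃, map_a₄, map_a₆,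
    eq_intCast, h₁, h₃, Int.cast_zero]
  push_cast
  linear_combination 4 * hx

/-! ### §2 Finite bookkeeping mod `2` and mod `8` -/

/-- `g = x³ + ax² + bx + c` has no `𝔽₂`-root iff `c` and `a + b` are odd. [folklore] -/
theorem zmod2_cubic_no_root_iff (a b c : ZMod 2) :
    (∀ r : ZMod 2, r ^ 3 + a * r ^ 2 + b * r + c ≠ 0) ↔ (c = 1 ∧ a + b = 1) := by
  revert a b c; decide

/-- If `disc(g)` is odd, every `𝔽₂`-root of `g` is simple. [folklore] -/
theorem zmod2_deriv_ne_zero_of_disc (a b c r : ZMod 2)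
    (hd : a ^ 2 * b ^ 2 - 4 * b ^ 3 - 4 * a ^ 3 * c + 18 * a * b * c - 27 * c ^ 2 = 1)
    (hr : r ^ 3 + a * r ^ 2 + b * r + c = 0) : 3 * r ^ 2 + 2 * a * r + b ≠ 0 := by
  revert a b c r hd hr; decide

/-- For ODD `d = disc(x³ + ax² + bx + c)`: `d ≡ 1 (mod 8)` iff `c` and `a + b` are odd (else `d ≡ 5 (mod 8)`); oddness in `ℤ/8` is
`z² = 1`. [folklore] -/
theorem zmod8_cubicDisc_eq_one_iff (x y z : ZMod 8)
    (hd : (x ^ 2 * y ^ 2 - 4 * y ^ 3 - 4 * x ^ 3 * z + 18 * x * y * z - 27 * z ^ 2) *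
      (x ^ 2 * y ^ 2 - 4 * y ^ 3 - 4 * x ^ 3 * z + 18 * x * y * z - 27 * z ^ 2) = 1) :
    x ^ 2 * y ^ 2 - 4 * y ^ 3 - 4 * x ^ 3 * z + 18 * x * y * z - 27 * z ^ 2 = 1 ↔ (z * z = 1 ∧ (x + y) * (x + y) = 1) := by
  revert x y z; decide

/-- In `ℤ/8`, `k² = 1` iff `k` is odd. [folklore] -/
theorem zmod8_intCast_sq_eq_one_iff (k : ℤ) : (k : ZMod 8) * (k : ZMod 8) = 1 ↔ ¬ (2 : ℤ) ∣ k := by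
  constructor
  · rintro h ⟨j, rfl⟩
    push_cast at h
    revert h; generalize (j : ZMod 8) = t; revert t; decide
  · intro hk
    have h1 : k % 2 = 1 := by
      rcases Int.emod_two_eq_zero_or_one k with h | h
      · exact absurd (Int.dvd_of_emod_eq_zero h) hk
      · exact h
    obtain ⟨j, hj⟩ : ∃ j, k = 2 * j + 1 := ⟨k / 2, by omega⟩
    rw [hj]; push_cast
    generalize (j : ZMod 8) = t; revert t; decide

/-- In `ℤ/2`, `k = 1` iff `k` is odd. [folklore] -/
theorem zmod2_intCast_eq_one_iff (k : ℤ) : (k : ZMod 2) = 1 ↔ ¬ (2 : ℤ) ∣ k := by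
  constructor
  · intro h hk
    rw [(ZMod.intCast_zmod_eq_zero_iff_dvd k 2).mpr (by exact_mod_cast hk)] at h
    exact zero_ne_one h
  · intro hk
    have h1 : k % 2 = 1 := by
      rcases Int.emod_two_eq_zero_or_one k with h | h
      · exact absurd (Int.dvd_of_emod_eq_zero h) hk
      · exact h
    obtain ⟨j, hj⟩ : ∃ j, k = 2 * j + 1 := ⟨k / 2, by omega⟩
    rw [hj]; push_cast
    generalize (j : ZMod 2) = t; revert t; decide

/-! ### §3 Hensel: an `𝔽₂`-root of `g` lifts when `disc(g)` is odd -/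

/-- **Hensel for the integer cubic `g = x³ + a₂x² + a₄x + a₆` at `p = 2`**: if `disc(g)` is odd and `g` has a root mod `2`, then `g` has a
root in `ℤ₂` (the root mod `2` is simple by `zmod2_deriv_ne_zero_of_disc`; Mathlib's `hensels_lemma`). [folklore] -/
theorem exists_intCubic_root_of_zmod2_root (a₂ a₄ a₆ : ℤ)
    (hd : ¬ (2 : ℤ) ∣ a₂ ^ 2 * a₄ ^ 2 - 4 * a₄ ^ 3 - 4 * a₂ ^ 3 * a₆ + 18 * a₂ * a₄ * a₆ - 27 * a₆ ^ 2)
    {r : ℤ} (hr : ((r ^ 3 + a₂ * r ^ 2 + a₄ * r + a₆ : ℤ) : ZMod 2) = 0) :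
    ∃ z : ℤ_[2], z ^ 3 + (a₂ : ℤ_[2]) * z ^ 2 + (a₄ : ℤ_[2]) * z + (a₆ : ℤ_[2]) = 0 := by
  set F : Polynomial ℤ := X ^ 3 + C a₂ * X ^ 2 + C a₄ * X + C a₆ with hF
  have hev : ∀ z : ℤ_[2], F.aeval z = z ^ 3 + (a₂ : ℤ_[2]) * z ^ 2 + (a₄ : ℤ_[2]) * z + (a₆ : ℤ_[2]) := fun z => by
    simp [hF]
  have hder : ∀ z : ℤ_[2], F.derivative.aeval z = 3 * z ^ 2 + 2 * (a₂ : ℤ_[2]) * z + (a₄ : ℤ_[2]) := fun z => by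
    simp [hF, derivative_mul, map_ofNat]
    ring
  -- the root mod 2 is simple
  have hd2 : ((a₂ : ZMod 2)) ^ 2 * (a₄ : ZMod 2) ^ 2 - 4 * (a₄ : ZMod 2) ^ 3 - 4 * (a₂ : ZMod 2) ^ 3 * (a₆ : ZMod 2) +
      18 * (a₂ : ZMod 2) * (a₄ : ZMod 2) * (a₆ : ZMod 2) - 27 * (a₆ : ZMod 2) ^ 2 = 1 := by
    have := (zmod2_intCast_eq_one_iff _).mpr hd
    push_cast at this
    exact this
  have hr2 : (r : ZMod 2) ^ 3 + (a₂ : ZMod 2) * (r : ZMod 2) ^ 2 + (a₄ : ZMod 2) * (r : ZMod 2) + (a₆ : ZMod 2) = 0 := by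
    push_cast at hr; exact hr
  have hsimple := zmod2_deriv_ne_zero_of_disc _ _ _ _ hd2 hr2
  -- norms at the integer point `r`
  have hval : ‖F.aeval ((r : ℤ) : ℤ_[2])‖ < 1 := by
    rw [hev]
    have e : ((r : ℤ_[2])) ^ 3 + (a₂ : ℤ_[2]) * (r : ℤ_[2]) ^ 2 + (a₄ : ℤ_[2]) * (r : ℤ_[2]) + (a₆ : ℤ_[2]) =
        ((r ^ 3 + a₂ * r ^ 2 + a₄ * r + a₆ : ℤ) : ℤ_[2]) := by push_cast; ring
    rw [e, PadicInt.norm_int_lt_one_iff_dvd]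
    exact_mod_cast (ZMod.intCast_zmod_eq_zero_iff_dvd _ 2).mp hr
  have hder1 : ‖F.derivative.aeval ((r : ℤ) : ℤ_[2])‖ = 1 := by
    rw [hder]
    have e : 3 * ((r : ℤ_[2])) ^ 2 + 2 * (a₂ : ℤ_[2]) * (r : ℤ_[2]) + (a₄ : ℤ_[2]) =
        ((3 * r ^ 2 + 2 * a₂ * r + a₄ : ℤ) : ℤ_[2]) := by push_cast; ring
    rw [e]
    have hodd : ¬ (2 : ℤ) ∣ 3 * r ^ 2 + 2 * a₂ * r + a₄ := by
      intro h
      have h0 := (ZMod.intCast_zmod_eq_zero_iff_dvd _ 2).mpr (by exact_mod_cast h)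
      push_cast at h0
      exact hsimple h0
    have hlt : ¬ ‖((3 * r ^ 2 + 2 * a₂ * r + a₄ : ℤ) : ℤ_[2])‖ < 1 := by
      rw [PadicInt.norm_int_lt_one_iff_dvd]; exact_mod_cast hodd
    exact le_antisymm (PadicInt.norm_le_one _) (not_lt.mp hlt)
  have hnorm : ‖F.aeval ((r : ℤ) : ℤ_[2])‖ < ‖F.derivative.aeval ((r : ℤ) : ℤ_[2])‖ ^ 2 := by
    rw [hder1, one_pow]; exact hval
  obtain ⟨z, hz, -⟩ := hensels_lemma hnorm
  exact ⟨z, by rw [← hev]; exact hz⟩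

/-! ### §4 T-desc-IV♮(a) by value -/

/-- **T-desc-IV♮(a) `DescG15d.TypeFourLocalTwoTorsionCriterion` BY VALUE (statement verbatim; census 122/122 + OOS 173/173)**: on the tame
cell `4 ∥ N`, for Kodaira type `IV` at `2` (`v₂(Δ_min) = 4`): `E(ℚ₂)[2] = 0` (no `ℚ₂`-root of the 2-division cubic,
`TameTwoLocal.NoLocalTwoTorsionAtTwo`) ⟺ `Δ_min/2⁴ ≡ 1 (mod 8)`.  [cite: SilvermanATAEC1994, IV.9.4 and Table 4.1] -/
theorem typeFourLocalTwoTorsionCriterion :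
    ∀ (W : WeierstrassCurve ℚ) [W.IsElliptic] [W.IsGloballyMinimal],
      2 ^ 2 ∣ W.conductorNorm ℤ → ¬ 2 ^ 3 ∣ W.conductorNorm ℤ →
        padicValInt 2 W.minimalDiscriminantInt = 4 →
          (NoLocalTwoTorsionAtTwo W ↔ W.minimalDiscriminantInt / 2 ^ 4 ≡ 1 [ZMOD 8]) := by
  intro W _ _ h4 h8 hΔ4
  -- additive reduction at `2` (`f₂ = 2`)
  set v : HeightOneSpectrum ℤ := (primesEquiv (R := ℤ)).symm ⟨2, Nat.prime_two⟩ with hvdef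
  have hv : natGenerator v = 2 :=
    Literature.NumberTheory.EllipticCurves.Rat.natGenerator_primesEquiv_symm ⟨2, Nat.prime_two⟩
  have hf : W.conductorExponent v = 2 := W.conductorExponent_eq_two_of_four_dvd_conductorNorm v hv h4 h8
  have haddZ : W.HasAdditiveReductionAt v := (W.two_le_conductorExponent_iff_holds v).mp (by omega)
  have hadd : W.HasAdditiveReductionAt ((primesEquiv (R := 𝓞 ℚ)).symm ⟨2, Nat.prime_two⟩) :=
    (W.hasAdditiveReductionAt_int_iff_ringOfIntegers ⟨2, Nat.prime_two⟩).mp haddZ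
  -- the `a₁ = a₃ = 0` globally minimal companion
  obtain ⟨C, M, hu, hCW, hM1, hM3, -⟩ := exists_smul_eq_map_a₁_a₃_eq_zero_of_hasAdditiveReductionAt_two W hadd
  set d : ℤ := M.a₂ ^ 2 * M.a₄ ^ 2 - 4 * M.a₄ ^ 3 - 4 * M.a₂ ^ 3 * M.a₆ + 18 * M.a₂ * M.a₄ * M.a₆ - 27 * M.a₆ ^ 2
    with hd
  have hMΔ : M.Δ = 16 * d := by
    rw [hd]
    simp only [WeierstrassCurve.Δ, WeierstrassCurve.b₂, WeierstrassCurve.b₄, WeierstrassCurve.b₆, WeierstrassCurve.b₈,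
      hM1, hM3]
    ring
  have hmin' : W.minimalDiscriminantInt = M.Δ := by
    have h1 : (W.minimalDiscriminantInt : ℚ) = W.Δ := cast_minimalDiscriminantInt W
    have h2 : (C • W).Δ = W.Δ := by rw [variableChange_Δ, hu]; simp
    have h3 : (C • W).Δ = (M.Δ : ℚ) := by rw [hCW, map_Δ, eq_intCast]
    exact_mod_cast (h1.trans (h2.symm.trans h3))
  have hMΔne : M.Δ ≠ 0 := by rw [← hmin']; exact minimalDiscriminantInt_ne_zero W
  have hodd : ¬ (2 : ℤ) ∣ d := by
    rintro ⟨k, hk⟩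
    have h32 : ((2 : ℕ) : ℤ) ^ 5 ∣ M.Δ := ⟨k, by rw [hMΔ, hk]; push_cast; ring⟩
    rw [padicValInt_dvd_iff] at h32
    rcases h32 with h0 | h5
    · exact hMΔne h0
    · rw [← hmin', hΔ4] at h5; omega
  have hdiv : W.minimalDiscriminantInt / 2 ^ 4 = d := by
    rw [hmin', hMΔ]
    norm_num
  rw [hdiv]
  -- STEP 1: `NoLocalTwoTorsionAtTwo W ↔ g` has no root mod 2
  have hstep1 : NoLocalTwoTorsionAtTwo W ↔ ((M.a₆ : ZMod 2) = 1 ∧ (M.a₂ : ZMod 2) + (M.a₄ : ZMod 2) = 1) := by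
    rw [← zmod2_cubic_no_root_iff]
    constructor
    · -- a root mod 2 lifts (Hensel) and transports back to `W`
      intro hno r hr
      obtain ⟨z, hz⟩ := exists_intCubic_root_of_zmod2_root M.a₂ M.a₄ M.a₆ hodd (r := (r.val : ℤ)) (by
        have e : ((r.val : ℕ) : ZMod 2) = r := ZMod.natCast_zmod_val r
        push_cast; rw [e]; exact hr)
      have hzQ : (z : ℚ_[2]) ^ 3 + (M.a₂ : ℚ_[2]) * (z : ℚ_[2]) ^ 2 + (M.a₄ : ℚ_[2]) * (z : ℚ_[2]) + (M.a₆ : ℚ_[2]) = 0 := by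
        have := congrArg (fun t : ℤ_[2] => (t : ℚ_[2])) hz
        simpa using this
      have h1 := isLocalTwoTorsionX_map_of_cubic_eq_zero M hM1 hM3 hzQ
      rw [← hCW] at h1
      have h2 := isLocalTwoTorsionX_of_smul_sub_of_u_eq_one W C hu (x := (z : ℚ_[2]) + (C.r : ℚ_[2])) (by simpa using h1)
      exact hno _ h2
    · -- a `ℚ₂`-root transports to `M`, is integral, and reduces to a root mod 2
      intro hno t ht
      have ht' : IsLocalTwoTorsionX W t := ht
      have h1 := cubic_eq_zero_of_isLocalTwoTorsionX_map M hM1 hM3 (hCW ▸ isLocalTwoTorsionX_smul_sub_of_u_eq_one W C hu ht')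
      set s : ℚ_[2] := t - (C.r : ℚ_[2]) with hs
      have hn : ∀ k : ℤ, ‖((k : ℚ_[2]))‖ ≤ 1 := fun k => Padic.norm_int_le_one (p := 2) k
      have hs1 : ‖s‖ ≤ 1 := padic_norm_le_one_of_monic_cubic_root (hn _) (hn _) (hn _) h1
      set sz : ℤ_[2] := ⟨s, hs1⟩ with hsz
      have hszeq : sz ^ 3 + (M.a₂ : ℤ_[2]) * sz ^ 2 + (M.a₄ : ℤ_[2]) * sz + (M.a₆ : ℤ_[2]) = 0 := by
        apply Subtype.ext
        push_cast
        exact h1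
      have hred := congrArg (PadicInt.toZMod (p := 2)) hszeq
      simp only [map_add, map_mul, map_pow, map_intCast, map_zero] at hred
      exact hno (PadicInt.toZMod sz) hred
  rw [hstep1]
  -- STEP 2: `d ≡ 1 (mod 8)` iff `a₆`, `a₂ + a₄` odd
  have hd8 : d ≡ 1 [ZMOD 8] ↔ (d : ZMod 8) = 1 := by
    constructor
    · intro h
      have := (ZMod.intCast_eq_intCast_iff (a := d) (b := 1) (c := 8)).mpr (by exact_mod_cast h)
      simpa using this
    · intro h
      have h' : ((d : ℤ) : ZMod 8) = ((1 : ℤ) : ZMod 8) := by simpa using h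
      exact_mod_cast (ZMod.intCast_eq_intCast_iff (a := d) (b := 1) (c := 8)).mp h'
  rw [hd8]
  have hdcast : (d : ZMod 8) = (M.a₂ : ZMod 8) ^ 2 * (M.a₄ : ZMod 8) ^ 2 - 4 * (M.a₄ : ZMod 8) ^ 3 -
      4 * (M.a₂ : ZMod 8) ^ 3 * (M.a₆ : ZMod 8) + 18 * (M.a₂ : ZMod 8) * (M.a₄ : ZMod 8) * (M.a₆ : ZMod 8) -
      27 * (M.a₆ : ZMod 8) ^ 2 := by
    rw [hd]; push_cast; ring
  have hdsq : (d : ZMod 8) * (d : ZMod 8) = 1 := (zmod8_intCast_sq_eq_one_iff d).mpr hodd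
  rw [hdcast] at hdsq
  rw [hdcast, zmod8_cubicDisc_eq_one_iff _ _ _ hdsq]
  have e2 : ((M.a₂ : ZMod 2) + (M.a₄ : ZMod 2)) = ((M.a₂ + M.a₄ : ℤ) : ZMod 2) := by push_cast; rfl
  have e8 : ((M.a₂ : ZMod 8) + (M.a₄ : ZMod 8)) = ((M.a₂ + M.a₄ : ℤ) : ZMod 8) := by push_cast; rfl
  rw [e2, e8, zmod2_intCast_eq_one_iff, zmod2_intCast_eq_one_iff, zmod8_intCast_sq_eq_one_iff, zmod8_intCast_sq_eq_one_iff]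

end LocalTwoTorsionDiscUnit

end Summit.BirchSwinnertonDyer.BirchSwinnertonDyer.Theorems.ManinLocalTwoThree

end
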